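import Summits.Ventures.Crystal3D.Theorems.StickyWulffConstantGenericWallFloorStackLedgerLocalCount
import HarnessLib

/-!
# The count at one end ball with PRICED cross-grain pairs: `deg y + #(end states at y) ≤ 12`
# (crux `GenericWallFloor`, line `WallLedgerG`; towards full charge on the one-sided part of the ray-aligned core)

HONEST FRAMING. Part of the venture `Summits/Ventures/Crystal3D` (cell `crystal3d-full`), helper `--supports` the
crux `GenericWallFloor` (stmt-Ventures-19480) of `route-Ventures-StickyWulffConstant`, registered line `WallLedgerG`,
open stub `stub_twoSlabAdhesion` (general fillings).  Rung credit only; F-C1 not moved; NOT the stub.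

`card_contacts_add_endStates_le_twelve_sep` (19480-p2 g4) counts the end states of BOTH grains at one ball when the two
frame sets are SEPARATED: every cross-grain pair of top frames is non-co-axial, hence (by `DoubleStarCoaxialAt` /
`CapPairCoaxial`) the two owned closed stars are different and cover the contacts of the ball.  On the ray-aligned core
separation fails, but the count only needs, for each cross-grain pair of states meeting at the ball, EITHER
non-co-axiality OR directly the two consequences «different stars» and «covering».  This file states the count in
that form:

**`card_contacts_add_endStates_le_twelve_cross`** — as the separated count, with the separation hypothesis replaced by
`hcross`: for every state of grain 1 and every state of grain 2 at `y`, the top frames are non-co-axial OR their closed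
stars at `y` are different and cover the contacts of `y`.  Same-grain pairs are priced as before
(`not_coaxial_of_two_states`).  The ledger `…StackLedgerCross` feeds `hcross` from a named stars-only input for the ONE
co-axial cross pair that survives on the one-sided core (the base frame of one grain against the lamella frame carried
by the other grain's walkers, both directions in the composition plane).
WHAT THIS IS NOT: not the stub; inputs `DoubleStarCoaxialAt`, `CapPairCoaxial` remain; F-C1 not moved.
-/

noncomputable section

namespace Summit.Ventures.Crystal3D.Theorems

open Finset
open Literature.MathematicalPhysics.StatisticalMechanics (fccStacking barlowStacking IsHaggSeq)
open scoped InnerProductSpace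

variable {X : Finset (EuclideanSpace ℝ (Fin 3))}

open scoped Classical in
/-- **`deg y + #(end states at y) ≤ 12` with priced cross-grain pairs.**  `ES₁`, `ES₂` are finite sets of walker
states AT `y` of grain 1 (vertical `z₁`, bottom entry `b₁`) and of grain 2 (`z₂`, `b₂ ≠ b₁`), each satisfying
`WalkInv`, `StackWF` and carrying the strong certificate; `y` has at most eleven contacts; and for every state of
grain 1 and every state of grain 2 the top frames are NON-co-axial, OR the two closed stars at `y` are different and
cover the contacts of `y` (`hcross`).  Inputs: `DoubleStarCoaxialAt` for all frame pairs and `CapPairCoaxial`. -/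
theorem card_contacts_add_endStates_le_twelve_cross (hX : ∀ p ∈ X, ∀ q ∈ X, p ≠ q → 1 ≤ dist p q)
    (hDS : ∀ F₁ F₂ : EuclideanSpace ℝ (Fin 3) ≃ₗᵢ[ℝ] EuclideanSpace ℝ (Fin 3), DoubleStarCoaxialAt F₁ F₂)
    (hCP : CapPairCoaxial)
    {b₁ b₂ : WalkEntry} (hbb : b₁ ≠ b₂)
    {z₁ z₂ y : EuclideanSpace ℝ (Fin 3)} (hdeg : (X.filter fun q => dist y q = 1).card ≤ 11)
    (ES₁ ES₂ : Finset (EuclideanSpace ℝ (Fin 3) × List WalkEntry))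
    (h₁ : ∀ s ∈ ES₁, s.1 = y ∧ WalkInv X z₁ s ∧ StackWF z₁ s.2 ∧ s.2.getLast? = some b₁ ∧
      (∃ e rest, s.2 = e :: rest ∧ WalkCertified12 X y e))
    (h₂ : ∀ s ∈ ES₂, s.1 = y ∧ WalkInv X z₂ s ∧ StackWF z₂ s.2 ∧ s.2.getLast? = some b₂ ∧
      (∃ e rest, s.2 = e :: rest ∧ WalkCertified12 X y e))
    (hcross : ∀ s ∈ ES₁, ∀ s' ∈ ES₂, ∀ e rest e' rest', s.2 = e :: rest → s'.2 = e' :: rest' →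
      (¬ ∃ (L : EuclideanSpace ℝ (Fin 3) ≃ₗᵢ[ℝ] EuclideanSpace ℝ (Fin 3))
          (s₁ s₂ : EuclideanSpace ℝ (Fin 3)) (σ σ' : ℤ → ℤ), IsHaggSeq σ ∧ IsHaggSeq σ' ∧
          e.frame '' fccStacking 1 (Real.sqrt (2 / 3)) ⊆ (fun p => L p + s₁) '' barlowStacking 1 (Real.sqrt (2 / 3)) σ ∧
          e'.frame '' fccStacking 1 (Real.sqrt (2 / 3)) ⊆ (fun p => L p + s₂) '' barlowStacking 1 (Real.sqrt (2 / 3)) σ') ∨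
      (starSet y e.frame e.dir ≠ starSet y e'.frame e'.dir ∧
        ∀ q ∈ X, dist y q = 1 → q ∈ starSet y e.frame e.dir ∪ starSet y e'.frame e'.dir)) :
    (X.filter fun q => dist y q = 1).card + ES₁.card + ES₂.card ≤ 12 := by
  -- shorthand for co-axiality of two frames
  let CoAx : (EuclideanSpace ℝ (Fin 3) ≃ₗᵢ[ℝ] EuclideanSpace ℝ (Fin 3)) →
      (EuclideanSpace ℝ (Fin 3) ≃ₗᵢ[ℝ] EuclideanSpace ℝ (Fin 3)) → Prop := fun F₁ F₂ =>
    ∃ (L : EuclideanSpace ℝ (Fin 3) ≃ₗᵢ[ℝ] EuclideanSpace ℝ (Fin 3))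
      (s₁ s₂ : EuclideanSpace ℝ (Fin 3)) (σ σ' : ℤ → ℤ), IsHaggSeq σ ∧ IsHaggSeq σ' ∧
      F₁ '' fccStacking 1 (Real.sqrt (2 / 3)) ⊆ (fun p => L p + s₁) '' barlowStacking 1 (Real.sqrt (2 / 3)) σ ∧
      F₂ '' fccStacking 1 (Real.sqrt (2 / 3)) ⊆ (fun p => L p + s₂) '' barlowStacking 1 (Real.sqrt (2 / 3)) σ'
  -- uniform data for a state of either grain
  have hdata : ∀ s ∈ ES₁ ∪ ES₂, s.1 = y ∧ y ∈ X ∧ ∃ e rest, s.2 = e :: rest ∧ e.dir ∈ fccSlots ∧ WalkCertified12 X y e := by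
    intro s hs
    rcases Finset.mem_union.1 hs with hs | hs
    · obtain ⟨hy, hI, -, -, ⟨e, rest, hse, hC⟩⟩ := h₁ s hs
      obtain ⟨hyX, hS, -⟩ := hI
      rw [hse] at hS; rw [hy] at hyX
      exact ⟨hy, hyX, e, rest, hse, hS.top.1, hC⟩
    · obtain ⟨hy, hI, -, -, ⟨e, rest, hse, hC⟩⟩ := h₂ s hs
      obtain ⟨hyX, hS, -⟩ := hI
      rw [hse] at hS; rw [hy] at hyX
      exact ⟨hy, hyX, e, rest, hse, hS.top.1, hC⟩
  -- same-grain pairs: different states at `y` have non-co-axial top frames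
  have key_same : ∀ (ES : Finset (EuclideanSpace ℝ (Fin 3) × List WalkEntry)) (z : EuclideanSpace ℝ (Fin 3)) (b : WalkEntry),
      (∀ s ∈ ES, s.1 = y ∧ WalkInv X z s ∧ StackWF z s.2 ∧ s.2.getLast? = some b ∧
        (∃ e rest, s.2 = e :: rest ∧ WalkCertified12 X y e)) →
      ∀ s ∈ ES, ∀ s' ∈ ES, s ≠ s' → ∀ e rest e' rest', s.2 = e :: rest → s'.2 = e' :: rest' →
      ¬ CoAx e.frame e'.frame := by
    intro ES z b hES s hs s' hs' hne e rest e' rest' hse hse'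
    obtain ⟨hy, hI, hW, hlast, -⟩ := hES s hs
    obtain ⟨hy', hI', hW', hlast', -⟩ := hES s' hs'
    obtain ⟨hyX, hS, e₀, rest₀, hstk, hC⟩ := hI
    obtain ⟨-, hS', e₀', rest₀', hstk', hC'⟩ := hI'
    rw [hse] at hstk hS hW hlast; rw [hse'] at hstk' hS' hW' hlast'
    injection hstk with he₀ _; injection hstk' with he₀' _
    subst he₀; subst he₀'
    rw [hy] at hC; rw [hy'] at hC'
    have hstne : e :: rest ≠ e' :: rest' := by
      intro h; apply hne; exact Prod.ext (by rw [hy, hy']) (by rw [hse, hse', h])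
    exact not_coaxial_of_two_states hX hS hW hC hS' hW' hC' (hlast.trans hlast'.symm) hstne
  -- from non-co-axiality to «different stars» and «covering» (the two inputs)
  have good_of_ncoax : ∀ (e e' : WalkEntry), e.dir ∈ fccSlots → e'.dir ∈ fccSlots → y ∈ X →
      WalkCertified12 X y e → WalkCertified12 X y e' → ¬ CoAx e.frame e'.frame →
      starSet y e.frame e.dir ≠ starSet y e'.frame e'.dir ∧
        ∀ q ∈ X, dist y q = 1 → q ∈ starSet y e.frame e.dir ∪ starSet y e'.frame e'.dir := by
    intro e e' hdir hdir' hy hC hC' hnc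
    refine ⟨fun hEq => hnc (coaxial_of_starSet_eq hdir hEq), fun q hq hqd => ?_⟩
    by_contra hnot
    rw [Finset.mem_union, not_or] at hnot
    have hoff : ∀ (F : EuclideanSpace ℝ (Fin 3) ≃ₗᵢ[ℝ] EuclideanSpace ℝ (Fin 3)) (v : EuclideanSpace ℝ (Fin 3)),
        q ∉ starSet y F v → ∀ w ∈ fccSlots, ⟪w, v⟫_ℝ < 0 → q ≠ y + F w := by
      intro F v hq' w hw hneg hqw
      apply hq'
      unfold starSet
      exact Finset.mem_image.2 ⟨w, Finset.mem_filter.2 ⟨hw, hneg⟩, hqw.symm⟩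
    exact hnc (coaxial_of_pair_certified hX (hDS e.frame e'.frame) hCP hdir hdir' hy hC.eta hC'.eta hq hqd
      (hoff e.frame e.dir hnot.1) (hoff e'.frame e'.dir hnot.2))
  -- every pair of distinct states is GOOD: different stars, covering
  have good : ∀ s ∈ ES₁ ∪ ES₂, ∀ s' ∈ ES₁ ∪ ES₂, s ≠ s' → ∀ e rest e' rest', s.2 = e :: rest → s'.2 = e' :: rest' →
      starSet y e.frame e.dir ≠ starSet y e'.frame e'.dir ∧
        ∀ q ∈ X, dist y q = 1 → q ∈ starSet y e.frame e.dir ∪ starSet y e'.frame e'.dir := by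
    intro s hs s' hs' hne e rest e' rest' hse hse'
    obtain ⟨-, hyX, e₀, rest₀, hse₀, hdir, hC⟩ := hdata s hs
    obtain ⟨-, -, e₀', rest₀', hse₀', hdir', hC'⟩ := hdata s' hs'
    rw [hse] at hse₀; rw [hse'] at hse₀'
    injection hse₀ with he₀ _; injection hse₀' with he₀' _
    subst he₀; subst he₀'
    rcases Finset.mem_union.1 hs with hs | hs <;> rcases Finset.mem_union.1 hs' with hs' | hs'
    · exact good_of_ncoax e e' hdir hdir' hyX hC hC' (key_same ES₁ z₁ b₁ h₁ s hs s' hs' hne e rest e' rest' hse hse')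
    · rcases hcross s hs s' hs' e rest e' rest' hse hse' with hnc | hgood
      · exact good_of_ncoax e e' hdir hdir' hyX hC hC' hnc
      · exact hgood
    · rcases hcross s' hs' s hs e' rest' e rest hse' hse with hnc | ⟨hne', hcov⟩
      · exact good_of_ncoax e e' hdir hdir' hyX hC hC' fun hco => hnc (coaxial_linear_symm hco)
      · exact ⟨fun h => hne' h.symm, fun q hq hqd => by rw [Finset.union_comm]; exact hcov q hq hqd⟩
    · exact good_of_ncoax e e' hdir hdir' hyX hC hC' (key_same ES₂ z₂ b₂ h₂ s hs s' hs' hne e rest e' rest' hse hse')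
  -- the two families of states are disjoint
  have hdisj : Disjoint ES₁ ES₂ := by
    rw [Finset.disjoint_left]
    intro s hs hs'
    obtain ⟨-, -, -, hl₁, -⟩ := h₁ s hs
    obtain ⟨-, -, -, hl₂, -⟩ := h₂ s hs'
    exact hbb (Option.some.inj (hl₁.symm.trans hl₂))
  -- the family of top pairs
  set 𝓟 := (ES₁ ∪ ES₂).image topPair with h𝓟
  have hinj : Set.InjOn topPair ↑(ES₁ ∪ ES₂) := by
    intro s hs s' hs' h
    by_contra hne
    obtain ⟨-, -, e, rest, hse, -, -⟩ := hdata s hs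
    obtain ⟨-, -, e', rest', hse', -, -⟩ := hdata s' hs'
    rw [topPair_eq hse, topPair_eq hse'] at h
    injection h with hf hd
    exact (good s hs s' hs' hne e rest e' rest' hse hse').1 (by rw [hf, hd])
  have hcard : 𝓟.card = ES₁.card + ES₂.card := by
    rw [h𝓟, Finset.card_image_of_injOn hinj, Finset.card_union_of_disjoint hdisj]
  -- members of `𝓟` come with their state
  have hmem : ∀ p ∈ 𝓟, ∃ s ∈ ES₁ ∪ ES₂, ∃ e rest, s.2 = e :: rest ∧ e.dir ∈ fccSlots ∧ WalkCertified12 X y e ∧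
      p = (e.frame, e.dir) := by
    intro p hp
    obtain ⟨s, hs, rfl⟩ := Finset.mem_image.1 hp
    obtain ⟨-, -, e, rest, hse, hdir, hC⟩ := hdata s hs
    exact ⟨s, hs, e, rest, hse, hdir, hC, topPair_eq hse⟩
  -- GOOD for pairs
  have goodP : ∀ p ∈ 𝓟, ∀ p' ∈ 𝓟, p ≠ p' →
      starSet y p.1 p.2 ≠ starSet y p'.1 p'.2 ∧ ∀ q ∈ X, dist y q = 1 → q ∈ starSet y p.1 p.2 ∪ starSet y p'.1 p'.2 := by
    intro p hp p' hp' hne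
    obtain ⟨s, hs, e, rest, hse, -, -, rfl⟩ := hmem p hp
    obtain ⟨s', hs', e', rest', hse', -, -, rfl⟩ := hmem p' hp'
    have hss : s ≠ s' := fun h => hne (by subst h; rw [hse] at hse'; injection hse' with h1 _; rw [h1])
    exact good s hs s' hs' hss e rest e' rest' hse hse'
  have hmain := card_contacts_add_card_le_twelve hdeg 𝓟 (fun p hp => ?_) (fun p hp => ?_)
    (fun p hp p' hp' hne => (goodP p hp p' hp' hne).1) (fun p hp p' hp' hne => (goodP p hp p' hp' hne).2)
  · rw [hcard] at hmain; omega
  · obtain ⟨s, hs, e, rest, hse, hdir, hC, rfl⟩ := hmem p hp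
    exact hdir
  · obtain ⟨s, hs, e, rest, hse, hdir, hC, rfl⟩ := hmem p hp
    exact star_owned_of_walkCertified hdir hC.walkCertified

end Summit.Ventures.Crystal3D.Theorems

end
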